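import Literature.NumberTheory.DiophantineGeometry.AbcShapeMoments
import Literature.NumberTheory.DiophantineGeometry.AbcShapeReduction
import HarnessLib

/-!
# The trivial bound for the shape counts (BBLT, Proposition 2.3 of arXiv v2)

"By fixing two of the three sets of variables in the defining equation of `B_d`, the remaining ones
are determined up to a divisor function" [BernertEtAl2024, Prop. 2.3 (arXiv v2; `prop:triv2`)]:
`B_d ≪_ε X^ε min(AB, AC, BC)` with `A = #box X` etc. Explicitly, with `D` a bound for `τ(m)`,
`1 ≤ m ≤ max cᵢ ∏(2·)^{i+1}`:

* `AbcShapes.tripleCount_le_XY` : `N(U,V,W) ≤ #box X · #box Y · D^d`,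
* `AbcShapes.tripleCount_le_XZ` : `N(U,V,W) ≤ #box X · #box Z · D^d`,
* `AbcShapes.tripleCount_le_YZ` : `N(U,V,W) ≤ #box Y · #box Z · D^d`

(and `B_d ≤ N(U,V,W)`, `shapeCount_le_tripleCount`). This is inequality (6.4) of the linear
programme of [BernertEtAl2024, Prop. 6.1]. Theorems 1.2/1.3 (named facts of
`AbcExceptionalSetBounds`) are NOT proved here.

## References

* [BernertEtAl2024] C. Bernert, T. Browning, J. D. Lichtman, J. Teräväinen, *Bounds on the
  exceptional set in the abc conjecture*, arXiv:2410.12234v2, Proposition 2.3 and (6.4).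
-/

noncomputable section

open Finset

namespace Literature.NumberTheory.DiophantineGeometry

namespace AbcShapes

/-- The tuples of a box with a prescribed value `c ∏ zᵢ^{i+1} = n` number at most `D^d`, if
`c ≥ 1`, the box has positive parameters and `τ(m) ≤ D` for `1 ≤ m ≤ c ∏ (2Zᵢ)^{i+1}` (they all
have the same `∏ zᵢ^{i+1}`, whose coordinates are among its divisors). [folklore] -/
theorem card_filter_vals_eq_le {d : ℕ} {c : ℕ} (hc : 0 < c) (Z : Fin d → ℕ) (hZ : ∀ i, 0 < Z i)
    {D : ℕ} (hD : ∀ m : ℕ, m ≠ 0 → m ≤ c * shapeVal (fun i => 2 * Z i) → m.divisors.card ≤ D)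
    (n : ℤ) : ((dyadicBox Z).filter (fun z => vals c z = n)).card ≤ D ^ d := by
  classical
  rcases ((dyadicBox Z).filter (fun z => vals c z = n)).eq_empty_or_nonempty with he | ⟨z₀, hz₀⟩
  · rw [he, card_empty]; exact Nat.zero_le _
  obtain ⟨hz₀B, hz₀n⟩ := mem_filter.mp hz₀
  have hpos : ∀ i, 0 < z₀ i := fun i => lt_of_lt_of_le (hZ i) ((mem_dyadicBox.mp hz₀B) i).1
  have hm0 : shapeVal z₀ ≠ 0 := (shapeVal_pos hpos).ne'
  have hmT : shapeVal z₀ ≤ c * shapeVal (fun i => 2 * Z i) :=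
    (shapeVal_mono fun i => ((mem_dyadicBox.mp hz₀B) i).2.le).trans (Nat.le_mul_of_pos_left _ hc)
  calc ((dyadicBox Z).filter (fun z => vals c z = n)).card
      ≤ ((dyadicBox Z).filter (fun z => shapeVal z = shapeVal z₀)).card := by
        refine card_le_card (fun z hz => ?_)
        obtain ⟨hzB, hzn⟩ := mem_filter.mp hz
        refine mem_filter.mpr ⟨hzB, Nat.eq_of_mul_eq_mul_left hc ?_⟩
        have : vals c z = vals c z₀ := hzn.trans hz₀n.symm
        simpa [vals] using this
    _ ≤ (shapeVal z₀).divisors.card ^ d := card_filter_shapeVal_eq_le _ hm0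
    _ ≤ D ^ d := Nat.pow_le_pow_left (hD _ hm0 hmT) d

/-- **Trivial bound, `(x, y)` fixed**: `N(U,V,W) ≤ #box X · #box Y · D^d`.
[cite: BernertEtAl2024, Proposition 2.3 (arXiv v2)] -/
theorem tripleCount_le_XY {d : ℕ} (c₁ c₂ : ℕ) {c₃ : ℕ} (hc₃ : 0 < c₃) (X Y Z : Fin d → ℕ)
    (hZ : ∀ i, 0 < Z i) {D : ℕ}
    (hD : ∀ m : ℕ, m ≠ 0 → m ≤ c₃ * shapeVal (fun i => 2 * Z i) → m.divisors.card ≤ D) :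
    tripleCount c₁ c₂ c₃ X Y Z ≤ (dyadicBox X).card * (dyadicBox Y).card * D ^ d := by
  classical
  rw [tripleCount, coinc, ← card_product]
  rw [card_eq_sum_card_fiberwise (f := Prod.fst) (t := dyadicBox X ×ˢ dyadicBox Y) (fun t ht => by
    exact mem_coe.mpr (mem_product.mp (mem_filter.mp (mem_coe.mp ht)).1).1)]
  calc _ ≤ ∑ p ∈ dyadicBox X ×ˢ dyadicBox Y, D ^ d := by
        refine sum_le_sum fun p hp => ?_
        refine le_trans ?_ (card_filter_vals_eq_le hc₃ Z hZ hD (vals c₁ p.1 + vals c₂ p.2))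
        refine card_le_card_of_injOn Prod.snd (fun t ht => ?_) (fun t ht t' ht' h => ?_)
        · obtain ⟨ht1, ht2⟩ := mem_filter.mp (mem_coe.mp ht)
          obtain ⟨htm, heq⟩ := mem_filter.mp ht1
          refine mem_coe.mpr (mem_filter.mpr ⟨(mem_product.mp htm).2, ?_⟩)
          rw [← ht2]; exact heq.symm
        · exact Prod.ext ((mem_filter.mp (mem_coe.mp ht)).2.trans
            (mem_filter.mp (mem_coe.mp ht')).2.symm) h
    _ = _ := by rw [sum_const, smul_eq_mul]

/-- **Trivial bound, `(x, z)` fixed**: `N(U,V,W) ≤ #box X · #box Z · D^d`.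
[cite: BernertEtAl2024, Proposition 2.3 (arXiv v2)] -/
theorem tripleCount_le_XZ {d : ℕ} (c₁ : ℕ) {c₂ : ℕ} (hc₂ : 0 < c₂) (c₃ : ℕ) (X Y Z : Fin d → ℕ)
    (hY : ∀ i, 0 < Y i) {D : ℕ}
    (hD : ∀ m : ℕ, m ≠ 0 → m ≤ c₂ * shapeVal (fun i => 2 * Y i) → m.divisors.card ≤ D) :
    tripleCount c₁ c₂ c₃ X Y Z ≤ (dyadicBox X).card * (dyadicBox Z).card * D ^ d := by
  classical
  rw [tripleCount, coinc, ← card_product]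
  rw [card_eq_sum_card_fiberwise (f := fun t => (t.1.1, t.2)) (t := dyadicBox X ×ˢ dyadicBox Z)
    (fun t ht => by
      have h := (mem_filter.mp (mem_coe.mp ht)).1
      simp only [mem_product] at h
      exact mem_coe.mpr (mem_product.mpr ⟨h.1.1, h.2⟩))]
  calc _ ≤ ∑ p ∈ dyadicBox X ×ˢ dyadicBox Z, D ^ d := by
        refine sum_le_sum fun p hp => ?_
        refine le_trans ?_ (card_filter_vals_eq_le hc₂ Y hY hD (vals c₃ p.2 - vals c₁ p.1))
        refine card_le_card_of_injOn (fun t => t.1.2) (fun t ht => ?_) (fun t ht t' ht' h => ?_)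
        · obtain ⟨ht1, ht2⟩ := mem_filter.mp (mem_coe.mp ht)
          obtain ⟨htm, heq⟩ := mem_filter.mp ht1
          simp only [mem_product] at htm
          refine mem_coe.mpr (mem_filter.mpr ⟨htm.1.2, ?_⟩)
          subst ht2
          simp only
          linarith
        · have e1 := (mem_filter.mp (mem_coe.mp ht)).2
          have e2 := (mem_filter.mp (mem_coe.mp ht')).2
          have e := e1.trans e2.symm
          simp only [Prod.mk.injEq] at e
          exact Prod.ext (Prod.ext e.1 h) e.2
    _ = _ := by rw [sum_const, smul_eq_mul]

/-- **Trivial bound, `(y, z)` fixed**: `N(U,V,W) ≤ #box Y · #box Z · D^d`.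
[cite: BernertEtAl2024, Proposition 2.3 (arXiv v2)] -/
theorem tripleCount_le_YZ {d : ℕ} {c₁ : ℕ} (hc₁ : 0 < c₁) (c₂ c₃ : ℕ) (X Y Z : Fin d → ℕ)
    (hX : ∀ i, 0 < X i) {D : ℕ}
    (hD : ∀ m : ℕ, m ≠ 0 → m ≤ c₁ * shapeVal (fun i => 2 * X i) → m.divisors.card ≤ D) :
    tripleCount c₁ c₂ c₃ X Y Z ≤ (dyadicBox Y).card * (dyadicBox Z).card * D ^ d := by
  classical
  rw [tripleCount, coinc, ← card_product]
  rw [card_eq_sum_card_fiberwise (f := fun t => (t.1.2, t.2)) (t := dyadicBox Y ×ˢ dyadicBox Z)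
    (fun t ht => by
      have h := (mem_filter.mp (mem_coe.mp ht)).1
      simp only [mem_product] at h
      exact mem_coe.mpr (mem_product.mpr ⟨h.1.2, h.2⟩))]
  calc _ ≤ ∑ p ∈ dyadicBox Y ×ˢ dyadicBox Z, D ^ d := by
        refine sum_le_sum fun p hp => ?_
        refine le_trans ?_ (card_filter_vals_eq_le hc₁ X hX hD (vals c₃ p.2 - vals c₂ p.1))
        refine card_le_card_of_injOn (fun t => t.1.1) (fun t ht => ?_) (fun t ht t' ht' h => ?_)
        · obtain ⟨ht1, ht2⟩ := mem_filter.mp (mem_coe.mp ht)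
          obtain ⟨htm, heq⟩ := mem_filter.mp ht1
          simp only [mem_product] at htm
          refine mem_coe.mpr (mem_filter.mpr ⟨htm.1.1, ?_⟩)
          subst ht2
          simp only
          linarith
        · have e1 := (mem_filter.mp (mem_coe.mp ht)).2
          have e2 := (mem_filter.mp (mem_coe.mp ht')).2
          have e := e1.trans e2.symm
          simp only [Prod.mk.injEq] at e
          exact Prod.ext (Prod.ext h e.1) e.2
    _ = _ := by rw [sum_const, smul_eq_mul]

end AbcShapes

end Literature.NumberTheory.DiophantineGeometry
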